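import Summits.BirchSwinnertonDyer.Rank1Residual.Additive.LocalLogImageRat
import Summits.BirchSwinnertonDyer.Rank1Residual.GaloisImage.FormalGroupSharpDivisionPadic
import Literature.NumberTheory.EllipticCurves.LocalTorsionAdditiveReductionPPrimaryProofs
import Literature.NumberTheory.EllipticCurves.CanonicalPAdicHeightThetaProofs
import Summits.BirchSwinnertonDyer.BirchSwinnertonDyer.Theorems.RamifiedSevenEllipticUnitsStrictControlAnyPrime
import Summits.BirchSwinnertonDyer.Rank1Residual.X12.CMGoodOrdinarySplit
import HarnessLib

/-!
# Route `PrintCFram`, crux C2 `BottomClassIndexLawFiveLe` (stmt-BirchSwinnertonDyer-20372), line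
# `eisenstein-resource-bdp-line` (registry v21: `stub_bsdp_of_level` = B1-level): **THE LEVEL BINDER IN ELEMENTARY CURRENCY, I —
# `p^k`-DIVISIBILITY IN `W(ℚ_p)` AT AN ADDITIVE PRIME `p ≥ 5` WITHOUT LOCAL `p`-TORSION IS READ ON THE DENOMINATOR OF `x(12 • P)`**
# (cell `bsd-print-cfram`, width seat `bsd-line-cfram-p1-w6` g5; helper `--supports` 20372; 0 defs, 0 facts, 0 sorry)

HONEST FRAMING. Nothing about BSD is proved here and no stub is closed: TOOL theorems that turn the crux's LEVEL binders —
`∃ Q : W(ℚ_[p]), p^n • Q = ι P` / `∀ Q, p^{n+1} • Q ≠ ι P` in `X12.O11.RamifiedCMBottomClassIndexLawAtZp` (the `n`, `n'` of the value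
law `c = n + n' + ord_p q + ord_p q'`) and the premise `∃ Q, p • Q = ι P` of v21's `stub_bsdp_of_level` (B1-level) — into a statement
about ONE rational number: the denominator of the `x`-coordinate of `12 • P`. Successor of w6 g4's lane (HANDOFF §w6 g4, item (ii)
«LEVEL 0 ⟸ x(12·g) p-integral via E₀/E₁»), proved here in both directions and at every depth `k`.

THE ARGUMENT (Silverman, *AEC* VII.2.1–2.2, IV.3.2, IV.6.4, VII.6.1, VII.6.3; all inputs are tree theorems). `W/ℚ` globally minimal,
ADDITIVE at `p` (`Addv W p`), `E = W(ℚ_p)`, `E⁽ᵏ⁾ = formalFiltration k` (`‖z‖ ≤ p⁻ᵏ`; `E⁽¹⁾ = E₁(ℚ_p)` the kernel of reduction).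
(⟹) `[E : E⁽¹⁾] = c_p · #Ẽ_ns(𝔽_p) = c_p · p` (`index_formalFiltration_one_of_additive`) with `c_p ∈ {1,2,3,4}` (Kodaira–Néron,
`localTamagawaNumber_padic_le_four_of_not_mult` — PROVED in the tree), so `(12p) • E ⊆ E⁽¹⁾`; and `p • E⁽ʲ⁾ ⊆ E⁽ʲ⁺¹⁾` (`j ≥ 1`; at `j = 1`
n1011's sharp estimate `norm_formalParameter_prime_nsmul_le_inv_sq`); hence `P = p^k • Q ⟹ 12 • P = p^{k-1} • (12p) • Q ∈ E⁽ᵏ⁾` — at ANY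
additive prime. (⟸) at `p ≥ 5` with `E[p] = 0`: the logarithm `log : E →+ ℚ_p` of `Rank1Residual.Additive.LocalLog` has kernel
`E_tors` (order prime to `p`) and image EXACTLY `ℤ_p` (`range_padicLog_baseChange_of_addv_of_not_dvd`: `p^{t − v_p c_p} ℤ_p` with
`t = 0`, `p ∤ c_p`); `12 • P ∈ E⁽ᵏ⁾ ⟹ p • 12 • P ∈ E⁽ᵏ⁺¹⁾ ⊆ E⁽²⁾` where `log` is the limit logarithm of norm `≤ p^{-(k+1)}`, and
`‖12p‖ = p⁻¹`, so `‖log P‖ ≤ p⁻ᵏ`, `log P = p^k log Q`, `P − p^k Q ∈ E_tors = p^k E_tors` (§1).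
COORDINATES: `(x, y) ∈ E⁽ᵏ⁾ ⟺ ‖x‖_p ≥ p^{2k}` (`‖z‖² = ‖x‖⁻¹`) `⟺ p^{2k} ∣ den x` for rational `x`.

* §1 `exists_nsmul_eq_of_apply_eq_nsmul` — division through a homomorphism with torsion kernel of order prime to the divisor.
* §2 (`X/ℚ_p` integral elliptic) `prime_nsmul_mem_formalFiltration_succ`, `pow_nsmul_mem_formalFiltration_add`,
  **`some_mem_formalFiltration_iff`** (`(x,y) ∈ E⁽ᵏ⁾ ↔ p^{2k} ≤ ‖x‖`), `not_dvd_natCard_torsion_of_forall_prime_nsmul`,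
  `natCard_torsion_nsmul_eq_zero_of_padicLog_eq_zero`, **`exists_pow_nsmul_eq_of_nsmul_mem_formalFiltration_of_range`** (the log core).
* §3 (`W/ℚ` globally minimal, `Addv W p`) `localTamagawaNumber_padic_dvd_twelve`, **`twelve_mul_prime_nsmul_mem_formalFiltration_one`**
  (`(12p) • E(ℚ_p) ⊆ E₁(ℚ_p)`), **`nsmul_mem_formalFiltration_of_pow_nsmul_eq`** (⟹, any additive `p`),
  **`exists_pow_nsmul_eq_of_nsmul_mem_formalFiltration`** (⟸, `p ≥ 5`, `E(ℚ_p)[p] = 0`),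
  **`exists_pow_nsmul_eq_iff_nsmul_mem_formalFiltration`**, `exists_prime_nsmul_eq_iff_isInReductionKernel` (`k = 1`).
* §4 (rational points) `pow_le_norm_ratCast_iff_pow_dvd_den`; **`exists_pow_nsmul_eq_toPadicPoint_iff_pow_dvd_den`**
  (`ι P ∈ p^k W(ℚ_p) ⟺ p^{2k} ∣ den x(12 • P)`), `pow_dvd_den_of_exists_pow_nsmul_eq_toPadicPoint` (necessity, any additive `p`),
  **`exists_pow_nsmul_eq_toPadicPoint_iff_pow_dvd_den_of_cmRamified`** — THE CM-RAMIFIED CLASS MEMBER (`Addv` by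
  `X12.addv_of_hasCM_of_cmRamified'`, `W(ℚ_p)[p] = 0` by k7r's `prime_nsmul_eq_zero_padic_of_hasCM_of_cmRamified`).

Sequel (`…LevelCriterionExactLevel`): the exact level `n = v_p(den x(12 • P))/2`, the crux's binder pair and B1-level in this currency.
THEOREMS ONLY; no definition, no named fact, no `sorry`. BSD is not proved by any of this; no summit statement is proved by this seat.
References: [SilvermanAEC2009] IV.3.2, IV.4.4, IV.6.4, VII.2.1–2.2, VII.3.1, VII.6.1, VII.6.3; [SilvermanATAEC1994] Cor. IV.9.2(d);
[Kim2022StructureSelmer] §3.2.3, Lemma 3.10 (the local index `log(E(ℚ_p)) = p^{t − v_p c_p} ℤ_p`); [Koblitz1984] Ch. I §2.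
-/

set_option autoImplicit false
-- `…BirchSwinnertonDyer.BirchSwinnertonDyer.Theorems…` is the problem's mandated namespace (D-0017).
set_option linter.dupNamespace false

noncomputable section

open scoped Classical

namespace Summit.BirchSwinnertonDyer.BirchSwinnertonDyer.Theorems.PrintCFram.LevelCriterion

open WeierstrassCurve Literature.NumberTheory.EllipticCurves Literature.NumberTheory.EllipticCurves.Rank1Residual
open Summit.BirchSwinnertonDyer.Rank1Residual.Additive.LocalLog
open Summit.BirchSwinnertonDyer.Rank1Residual.GaloisImage.LocalDivisibility

/-! ## §1 Group theory: divisibility modulo a torsion kernel of order prime to the divisor -/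

/-- **Division through a homomorphism whose kernel is `c`-torsion, `c` prime to `n`.** If `f P = n • f Q` for an additive
map `f` whose kernel is killed by some `c` coprime to `n`, then `P` is `n`-divisible: `P - n • Q = T` with `c • T = 0`,
and Bézout `a c + b n = 1` gives `T = n • (b • T)`. [folklore] -/
theorem exists_nsmul_eq_of_apply_eq_nsmul {G M : Type*} [AddCommGroup G] [AddCommGroup M] (f : G →+ M) {c n : ℕ}
    (hker : ∀ T : G, f T = 0 → c • T = 0) (hcn : c.Coprime n) {P Q : G} (h : f P = n • f Q) :
    ∃ R : G, n • R = P := by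
  set T := P - n • Q with hT
  have hT0 : c • T = 0 := hker T (by rw [hT, map_sub, map_nsmul, h, sub_self])
  obtain ⟨a, b, hab⟩ := Nat.isCoprime_iff_coprime.mpr hcn
  have hTb : T = (n : ℤ) • (b • T) := by
    calc T = (a * c + b * n) • T := by rw [hab, one_zsmul]
      _ = a • ((c : ℤ) • T) + (n : ℤ) • (b • T) := by rw [add_zsmul, mul_zsmul, mul_comm b, mul_zsmul]
      _ = (n : ℤ) • (b • T) := by rw [natCast_zsmul, hT0, zsmul_zero, zero_add]
  refine ⟨Q + b • T, ?_⟩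
  rw [nsmul_add, ← natCast_zsmul (b • T), ← hTb, hT, add_sub_cancel]


/-! ## §2 The filtration at an additive prime: `p • E⁽ⁿ⁾ ⊆ E⁽ⁿ⁺¹⁾` (`n ≥ 1`) and `(12 p) • E(ℚ_p) ⊆ E⁽¹⁾` (`p ≥ 5`) -/

section Local

variable {p : ℕ} [hp : Fact p.Prime] (X : WeierstrassCurve ℚ_[p]) [X.IsIntegral ℤ_[p]] [X.IsElliptic]

/-- **`p • E⁽ⁿ⁾(ℚ_p) ⊆ E⁽ⁿ⁺¹⁾(ℚ_p)` for `n ≥ 1`** (`E⁽ⁿ⁾ = W.formalFiltration n`, `‖z(P)‖ ≤ p⁻ⁿ`): at `n ≥ 2` this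
is `‖z(pP)‖ = p⁻¹‖z(P)‖` (tree `norm_formalParameter_p_nsmul`), at `n = 1` the sharp estimate
`norm_formalParameter_prime_nsmul_le_inv_sq` (`[p](t) = p f(t) + g(tᵖ)`). [cite: SilvermanAEC2009, IV.3.2(a), IV.4.4 and VII.2.2] -/
theorem prime_nsmul_mem_formalFiltration_succ {n : ℕ} (hn : 1 ≤ n) {Q : X.toAffine.Point}
    (hQ : Q ∈ X.formalFiltration n) : p • Q ∈ X.formalFiltration (n + 1) := by
  refine ⟨X.isInReductionKernel_nsmul hQ.1 p, ?_⟩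
  rcases Nat.lt_or_ge n 2 with h | h
  · obtain rfl : n = 1 := by omega
    exact norm_formalParameter_prime_nsmul_le_inv_sq X hQ.1 (by simpa only [pow_one] using hQ.2)
  · rw [X.norm_formalParameter_p_nsmul hQ.1 (X.norm_formalParameter_lt_inv_of_mem h hQ), pow_succ, mul_comm]
    exact mul_le_mul_of_nonneg_right hQ.2 (inv_nonneg.mpr (Nat.cast_nonneg _))

/-- `p^j • E⁽ⁿ⁾(ℚ_p) ⊆ E⁽ⁿ⁺ʲ⁾(ℚ_p)` for `n ≥ 1`. [cite: SilvermanAEC2009, IV.3.2(a) and VII.2.2] -/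
theorem pow_nsmul_mem_formalFiltration_add {n : ℕ} (hn : 1 ≤ n) {Q : X.toAffine.Point}
    (hQ : Q ∈ X.formalFiltration n) (j : ℕ) : p ^ j • Q ∈ X.formalFiltration (n + j) := by
  induction j with
  | zero => simpa only [pow_zero, one_nsmul, add_zero] using hQ
  | succ j ih =>
    have h := prime_nsmul_mem_formalFiltration_succ X (show 1 ≤ n + j by omega) ih
    rw [← mul_nsmul, ← pow_succ] at h
    rw [← add_assoc]
    exact h

omit hp in
/-- `(p⁻ᵏ)² = (p^{2k})⁻¹` in `ℝ`. [folklore] -/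
private theorem inv_pow_sq (k : ℕ) : (((p : ℝ)⁻¹) ^ k) ^ 2 = ((p : ℝ) ^ (2 * k))⁻¹ := by
  rw [inv_pow, inv_pow, ← pow_mul, mul_comm]

/-- **An affine point lies in `E⁽ᵏ⁾(ℚ_p)` (`k ≥ 1`) iff `‖x‖_p ≥ p^{2k}`** (`‖z‖² = ‖x‖⁻¹` on `E₁(ℚ_p)`, tree
`norm_formalParameter_sq`; `v_p(x) = -2 v_p(z)`). [cite: SilvermanAEC2009, VII.2.2] -/
theorem some_mem_formalFiltration_iff {k : ℕ} (hk : 1 ≤ k) {x y : ℚ_[p]} (h : X.toAffine.Nonsingular x y) :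
    (.some x y h : X.toAffine.Point) ∈ X.formalFiltration k ↔ (p : ℝ) ^ (2 * k) ≤ ‖x‖ := by
  have hpR : (1 : ℝ) < p := by exact_mod_cast hp.out.one_lt
  have hpk : (0 : ℝ) < (p : ℝ) ^ (2 * k) := by positivity
  rw [X.mem_formalFiltration_iff, X.isInReductionKernel_some h, X.formalParameter_some h]
  constructor
  · rintro ⟨hx, hz⟩
    have hx0 : 0 < ‖x‖ := one_pos.trans hx
    have h1 : ‖x‖⁻¹ ≤ ((p : ℝ) ^ (2 * k))⁻¹ := by
      rw [← X.norm_formalParameter_sq h.1 hx, ← inv_pow_sq]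
      exact pow_le_pow_left₀ (norm_nonneg _) hz 2
    exact (inv_le_inv₀ hx0 hpk).mp h1
  · intro hx
    have hx1 : 1 < ‖x‖ := lt_of_lt_of_le (one_lt_pow₀ hpR (by omega)) hx
    refine ⟨hx1, ?_⟩
    have hx0 : 0 < ‖x‖ := one_pos.trans hx1
    have h2 : ‖-x / y‖ ^ 2 ≤ (((p : ℝ)⁻¹) ^ k) ^ 2 := by
      rw [X.norm_formalParameter_sq h.1 hx1, inv_pow_sq]
      exact (inv_le_inv₀ hx0 hpk).mpr hx
    exact (pow_le_pow_iff_left₀ (norm_nonneg _) (by positivity) two_ne_zero).mp h2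



/-- **No element of order `p` ⟹ `p ∤ #E(ℚ_p)_tors`** (Cauchy). [folklore] -/
theorem not_dvd_natCard_torsion_of_forall_prime_nsmul (htors : ∀ Q : X.toAffine.Point, p • Q = 0 → Q = 0) :
    ¬ p ∣ Nat.card (AddCommGroup.torsion X.toAffine.Point) := by
  haveI := finite_torsion_point X
  intro hdvd
  obtain ⟨x, hx⟩ := exists_prime_addOrderOf_dvd_card' p hdvd
  have hx' := addOrderOf_nsmul_eq_zero x
  rw [hx] at hx'
  have hx0 : p • (x : X.toAffine.Point) = 0 := by
    rw [← AddSubgroupClass.coe_nsmul, hx', ZeroMemClass.coe_zero]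
  have hx1 : x = 0 := Subtype.ext (htors _ hx0)
  rw [hx1, addOrderOf_zero] at hx
  exact hp.out.one_lt.ne hx

/-- The kernel of `log` is killed by `#E(ℚ_p)_tors`. [cite: SilvermanAEC2009, IV.6.4 and VII.6.3] -/
theorem natCard_torsion_nsmul_eq_zero_of_padicLog_eq_zero {T : X.toAffine.Point} (hT : padicLog X T = 0) :
    Nat.card (AddCommGroup.torsion X.toAffine.Point) • T = 0 := by
  have hmem : T ∈ AddCommGroup.torsion X.toAffine.Point := (padicLog_eq_zero_iff X T).mp hT
  have h := card_nsmul_eq_zero' (x := (⟨T, hmem⟩ : AddCommGroup.torsion X.toAffine.Point))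
  rwa [Subtype.ext_iff, AddSubgroupClass.coe_nsmul, ZeroMemClass.coe_zero] at h

/-- **CORE OF THE CONVERSE: `12 • P ∈ E⁽ᵏ⁾(ℚ_p)` ⟹ `P ∈ p^k E(ℚ_p)`** (`k ≥ 1`, `p ≥ 5`) for a `p`-integral elliptic `X/ℚ_p`
whose logarithm lattice is `log(E(ℚ_p)) = ℤ_p` EXACTLY and whose torsion has order prime to `p`: `p • 12 • P ∈ E⁽ᵏ⁺¹⁾ ⊆ E⁽²⁾`,
where `log` is the limit logarithm, of norm `‖z‖ ≤ p^{-(k+1)}`; `‖12 p‖ = p⁻¹` gives `‖log P‖ ≤ p⁻ᵏ`, so `log P / pᵏ ∈ ℤ_p` is a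
value `log Q`, and `P - pᵏ • Q` lies in the kernel = torsion, of order prime to `pᵏ` (§1).
[cite: SilvermanAEC2009, IV.6.4, VII.2.2, VII.6.3] -/
theorem exists_pow_nsmul_eq_of_nsmul_mem_formalFiltration_of_range (hp5 : 5 ≤ p)
    (hrange : (padicLog X).range = (Submodule.span ℤ_[p] {(1 : ℚ_[p])}).toAddSubgroup)
    (htc : ¬ p ∣ Nat.card (AddCommGroup.torsion X.toAffine.Point))
    {P : X.toAffine.Point} {k : ℕ} (hk : 1 ≤ k) (h : 12 • P ∈ X.formalFiltration k) :
    ∃ Q : X.toAffine.Point, p ^ k • Q = P := by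
  have hpR : (0 : ℝ) < p := by exact_mod_cast hp.out.pos
  have hp0 : (p : ℚ_[p]) ≠ 0 := Nat.cast_ne_zero.mpr hp.out.ne_zero
  -- `p • 12 • P ∈ E⁽ᵏ⁺¹⁾ ⊆ E⁽²⁾`, so its log is the limit log, of norm `≤ p^{-(k+1)}`
  have hR := prime_nsmul_mem_formalFiltration_succ X hk h
  have hR2 : p • 12 • P ∈ X.formalFiltration 2 := X.formalFiltration_antitone (by omega : 2 ≤ k + 1) hR
  have hnorm : ‖padicLog X (p • 12 • P)‖ ≤ ((p : ℝ)⁻¹) ^ (k + 1) := by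
    rw [padicLog_apply_of_mem X hR2, X.norm_padicLimitLog_of_mem (by omega) hR]
    exact hR.2
  have hlin : padicLog X (p • 12 • P) = ((p : ℚ_[p]) * 12) * padicLog X P := by
    rw [map_nsmul, map_nsmul, nsmul_eq_mul, nsmul_eq_mul]
    push_cast
    ring
  have hcop : Nat.Coprime p 12 := by
    have h2 : Nat.Coprime p 2 := (Nat.coprime_primes hp.out Nat.prime_two).mpr (by omega)
    have h3 : Nat.Coprime p 3 := (Nat.coprime_primes hp.out Nat.prime_three).mpr (by omega)
    simpa using (h2.mul_right h2).mul_right h3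
  have h12 : ‖(12 : ℚ_[p])‖ = 1 := by
    rw [show (12 : ℚ_[p]) = ((12 : ℕ) : ℚ_[p]) by norm_cast, Padic.norm_natCast_eq_one_iff]
    exact hcop
  have hLP : ‖padicLog X P‖ ≤ ((p : ℝ)⁻¹) ^ k := by
    rw [hlin, norm_mul, norm_mul, h12, mul_one, Padic.norm_p, pow_succ'] at hnorm
    exact le_of_mul_le_mul_left hnorm (inv_pos.mpr hpR)
  -- hence `log P / p^k ∈ ℤ_p = log(E(ℚ_p))`
  have hy : padicLog X P / (p : ℚ_[p]) ^ k ∈ (padicLog X).range := by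
    rw [hrange, Submodule.mem_toAddSubgroup, Submodule.mem_span_singleton]
    refine ⟨⟨padicLog X P / (p : ℚ_[p]) ^ k, ?_⟩, by rw [Algebra.smul_def, mul_one]; rfl⟩
    rw [norm_div, norm_pow, Padic.norm_p, div_le_one (pow_pos (inv_pos.mpr hpR) k)]
    exact hLP
  obtain ⟨Q, hQ⟩ := hy
  have hPQ : padicLog X P = (p ^ k : ℕ) • padicLog X Q := by
    rw [hQ, nsmul_eq_mul, Nat.cast_pow, mul_div_cancel₀ _ (pow_ne_zero k hp0)]
  refine exists_nsmul_eq_of_apply_eq_nsmul (padicLog X) (c := Nat.card (AddCommGroup.torsion X.toAffine.Point))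
    (fun T hT => natCard_torsion_nsmul_eq_zero_of_padicLog_eq_zero X hT) ?_ hPQ
  exact Nat.Coprime.pow_right k (Nat.Coprime.symm ((Nat.Prime.coprime_iff_not_dvd hp.out).mpr htc))

end Local

/-! ## §3 `W/ℚ` globally minimal, ADDITIVE at `p`: `(12 p) • E(ℚ_p) ⊆ E⁽¹⁾(ℚ_p)`; `p^k`-divisibility ⟹ `12 • P ∈ E⁽ᵏ⁾`;
and conversely at `p ≥ 5` without local `p`-torsion -/

section Rat

variable (W : WeierstrassCurve ℚ) [W.IsElliptic] [W.IsGloballyMinimal] (p : ℕ) [hp : Fact p.Prime]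

omit [W.IsGloballyMinimal] in
/-- `c_p ∈ {1, 2, 3, 4}` at an additive prime, hence **`c_p ∣ 12`** (Kodaira–Néron; tree `localTamagawaNumber_padic_le_four_of_not_mult`,
`localTamagawaNumber_padic_ne_zero_holds`). [cite: SilvermanATAEC1994, Cor. IV.9.2(d) (PDF p. 340)] -/
theorem localTamagawaNumber_padic_dvd_twelve (hadd : Addv W p) :
    (W.baseChange ℚ_[p]).localTamagawaNumber ℤ_[p] ∣ 12 := by
  haveI : (W.baseChange ℚ_[p]).IsElliptic := by rw [baseChange]; infer_instance
  have h4 := localTamagawaNumber_padic_le_four_of_not_mult W p hadd.2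
  have h0 := localTamagawaNumber_padic_ne_zero_holds p (W.baseChange ℚ_[p])
  set c := (W.baseChange ℚ_[p]).localTamagawaNumber ℤ_[p] with hc
  interval_cases c <;> omega

/-- **`(12 p) • E(ℚ_p) ⊆ E⁽¹⁾(ℚ_p)` at an ADDITIVE prime** (`[E(ℚ_p) : E⁽¹⁾(ℚ_p)] = c_p · p`, tree
`index_formalFiltration_one_of_additive`, and `c_p ∣ 12`). [cite: SilvermanAEC2009, VII.2 Prop. 2.1, Thm VII.6.1 and Exercise 3.5] -/
theorem twelve_mul_prime_nsmul_mem_formalFiltration_one (hadd : Addv W p) (Q : (W.baseChange ℚ_[p]).toAffine.Point) :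
    (12 * p) • Q ∈ (W.baseChange ℚ_[p]).formalFiltration 1 := by
  obtain ⟨d, hd⟩ := localTamagawaNumber_padic_dvd_twelve W p hadd
  have hmem := ((W.baseChange ℚ_[p]).formalFiltration 1).nsmul_index_mem Q
  rw [index_formalFiltration_one_of_additive W p hadd.1 hadd.2] at hmem
  have h12 : 12 * p = d * ((W.baseChange ℚ_[p]).localTamagawaNumber ℤ_[p] * p) := by rw [hd]; ring
  rw [h12, mul_comm, mul_nsmul]
  exact AddSubgroup.nsmul_mem _ hmem d

/-- **`p^k`-divisible in `E(ℚ_p)` ⟹ `12 • P ∈ E⁽ᵏ⁾(ℚ_p)`** (`k ≥ 1`, `W` globally minimal, ADDITIVE at `p` — any `p`):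
`12 • p^k • Q = p^{k-1} • (12p) • Q` with `(12p) • Q ∈ E⁽¹⁾` and `p^{k-1} • E⁽¹⁾ ⊆ E⁽ᵏ⁾`.
[cite: SilvermanAEC2009, VII.2 Prop. 2.1, IV.3.2(a), Thm VII.6.1] -/
theorem nsmul_mem_formalFiltration_of_pow_nsmul_eq (hadd : Addv W p) {P Q : (W.baseChange ℚ_[p]).toAffine.Point}
    {k : ℕ} (hk : 1 ≤ k) (h : p ^ k • Q = P) : 12 • P ∈ (W.baseChange ℚ_[p]).formalFiltration k := by
  haveI : (W.baseChange ℚ_[p]).IsElliptic := by rw [baseChange]; infer_instance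
  obtain ⟨j, rfl⟩ : ∃ j, k = j + 1 := ⟨k - 1, by omega⟩
  have h1 := twelve_mul_prime_nsmul_mem_formalFiltration_one W p hadd Q
  have h2 := pow_nsmul_mem_formalFiltration_add (W.baseChange ℚ_[p]) le_rfl h1 j
  rw [add_comm 1 j] at h2
  rw [← h, ← mul_nsmul] at *
  convert h2 using 2
  ring

/-- **`12 • P ∈ E⁽ᵏ⁾(ℚ_p)` ⟹ `P` is `p^k`-divisible in `E(ℚ_p)`** (`k ≥ 1`) for `W` globally minimal, ADDITIVE at `p ≥ 5`, with
`E(ℚ_p)[p] = 0`: `p • 12 • P ∈ E⁽ᵏ⁺¹⁾ ⊆ E⁽²⁾`, where `log` is the limit logarithm of norm `≤ p^{-(k+1)}`; `‖12 p‖ = p⁻¹` gives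
`‖log P‖ ≤ p⁻ᵏ`, i.e. `log P ∈ pᵏ · log(E(ℚ_p))` since `log(E(ℚ_p)) = ℤ_p` EXACTLY (`p ∤ c_p`, `p ∤ #E(ℚ_p)_tors`; tree
`range_padicLog_baseChange_of_addv_of_not_dvd`); the kernel of `log` is the torsion, of order prime to `p` (§1).
[cite: SilvermanAEC2009, IV.6.4, VII.2.2, VII.6.3] [cite: Kim2022StructureSelmer, Lemma 3.10 (PDF p. 17)] -/
theorem exists_pow_nsmul_eq_of_nsmul_mem_formalFiltration (hp5 : 5 ≤ p) (hadd : Addv W p)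
    (htors : ∀ Q : (W.baseChange ℚ_[p]).toAffine.Point, p • Q = 0 → Q = 0)
    {P : (W.baseChange ℚ_[p]).toAffine.Point} {k : ℕ} (hk : 1 ≤ k)
    (h : 12 • P ∈ (W.baseChange ℚ_[p]).formalFiltration k) :
    ∃ Q : (W.baseChange ℚ_[p]).toAffine.Point, p ^ k • Q = P := by
  haveI : (W.baseChange ℚ_[p]).IsElliptic := by rw [baseChange]; infer_instance
  have htc := not_dvd_natCard_torsion_of_forall_prime_nsmul (W.baseChange ℚ_[p]) htors
  have hcp : ¬ p ∣ (W.baseChange ℚ_[p]).localTamagawaNumber ℤ_[p] := by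
    intro hdvd
    have h4 := localTamagawaNumber_padic_le_four_of_not_mult W p hadd.2
    have h0 := localTamagawaNumber_padic_ne_zero_holds p (W.baseChange ℚ_[p])
    have := Nat.le_of_dvd (Nat.pos_of_ne_zero h0) hdvd
    omega
  have hrange : (padicLog (W.baseChange ℚ_[p])).range = (Submodule.span ℤ_[p] {(1 : ℚ_[p])}).toAddSubgroup := by
    rw [range_padicLog_baseChange_of_addv_of_not_dvd W p hadd hcp, padicValNat.eq_zero_of_not_dvd htc, pow_zero]
  exact exists_pow_nsmul_eq_of_nsmul_mem_formalFiltration_of_range (W.baseChange ℚ_[p]) hp5 hrange htc hk h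

/-- **THE LEVEL CRITERION (local form).** `W/ℚ` globally minimal, ADDITIVE at `p ≥ 5`, `E(ℚ_p)[p] = 0` (the binder
`∀ Q : W(ℚ_p), p • Q = 0 → Q = 0` of `X12.O11.RamifiedCMBottomClassIndexLawAtZp`), `P ∈ E(ℚ_p)`, `k ≥ 1`:
`P ∈ p^k E(ℚ_p)` **iff** `12 • P ∈ E⁽ᵏ⁾(ℚ_p)` (`‖z(12 • P)‖ ≤ p⁻ᵏ`, i.e. `v_p x(12 • P) ≤ -2k`).
[cite: SilvermanAEC2009, VII.2 Prop. 2.1–2.2, IV.6.4, VII.6.1, VII.6.3] -/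
theorem exists_pow_nsmul_eq_iff_nsmul_mem_formalFiltration (hp5 : 5 ≤ p) (hadd : Addv W p)
    (htors : ∀ Q : (W.baseChange ℚ_[p]).toAffine.Point, p • Q = 0 → Q = 0)
    (P : (W.baseChange ℚ_[p]).toAffine.Point) {k : ℕ} (hk : 1 ≤ k) :
    (∃ Q : (W.baseChange ℚ_[p]).toAffine.Point, p ^ k • Q = P) ↔ 12 • P ∈ (W.baseChange ℚ_[p]).formalFiltration k :=
  ⟨fun ⟨_, hQ⟩ => nsmul_mem_formalFiltration_of_pow_nsmul_eq W p hadd hk hQ,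
    exists_pow_nsmul_eq_of_nsmul_mem_formalFiltration W p hp5 hadd htors hk⟩

/-- **Level `≥ 1` (the B1-level binder's shape) iff `12 • P ∈ E₁(ℚ_p)`**, the kernel of reduction (`E⁽¹⁾ = E⁽⁰⁾ = E₁`).
[cite: SilvermanAEC2009, VII.2 Prop. 2.1–2.2 and VII.6.3] -/
theorem exists_prime_nsmul_eq_iff_isInReductionKernel (hp5 : 5 ≤ p) (hadd : Addv W p)
    (htors : ∀ Q : (W.baseChange ℚ_[p]).toAffine.Point, p • Q = 0 → Q = 0)
    (P : (W.baseChange ℚ_[p]).toAffine.Point) :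
    (∃ Q : (W.baseChange ℚ_[p]).toAffine.Point, p • Q = P) ↔ (W.baseChange ℚ_[p]).IsInReductionKernel (12 • P) := by
  haveI : (W.baseChange ℚ_[p]).IsElliptic := by rw [baseChange]; infer_instance
  have h := exists_pow_nsmul_eq_iff_nsmul_mem_formalFiltration W p hp5 hadd htors P le_rfl
  rw [pow_one] at h
  rw [h, (W.baseChange ℚ_[p]).formalFiltration_one_eq_zero, (W.baseChange ℚ_[p]).mem_formalFiltration_zero_iff]

end Rat


/-! ## §4 Rational points: `p^k`-divisibility of `ι P` in `W(ℚ_p)` iff `p^{2k} ∣ den x(12 • P)`; the CM-RAMIFIED class member -/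

section RatPoints

variable {p : ℕ} [hp : Fact p.Prime]

/-- **`‖x‖_p ≥ p^m` iff `p^m ∣ den x`** for a rational `x` and `m ≥ 1` (`‖x‖_p = p^{v_p(den x)}` when `p ∣ den x`, as then
`p ∤ num x`; `‖x‖_p ≤ 1` otherwise). [cite: Koblitz1984, Ch. I §2 (the `p`-adic norm on `ℚ`)] -/
theorem pow_le_norm_ratCast_iff_pow_dvd_den (x : ℚ) {m : ℕ} (hm : 1 ≤ m) :
    (p : ℝ) ^ m ≤ ‖(x : ℚ_[p])‖ ↔ p ^ m ∣ x.den := by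
  have hpR : (1 : ℝ) < p := by exact_mod_cast hp.out.one_lt
  by_cases hden : p ∣ x.den
  · have hx0 : x ≠ 0 := by
      rintro rfl
      rw [Rat.den_zero, Nat.dvd_one] at hden
      exact hp.out.ne_one hden
    have hnum : ¬ (p : ℤ) ∣ x.num := by
      intro h
      have h1 : p ∣ x.num.natAbs := Int.natCast_dvd.mp h
      have h2 : p ∣ Nat.gcd x.num.natAbs x.den := Nat.dvd_gcd h1 hden
      rw [x.reduced] at h2
      exact hp.out.ne_one (Nat.dvd_one.mp h2)
    have hnorm : ‖(x : ℚ_[p])‖ = (p : ℝ) ^ (padicValNat p x.den) := by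
      rw [Padic.eq_padicNorm, padicNorm.eq_zpow_of_nonzero hx0, padicValRat_def, padicValInt.eq_zero_of_not_dvd hnum]
      simp
    rw [hnorm, pow_le_pow_iff_right₀ hpR, padicValNat_dvd_iff_le x.den_nz]
  · constructor
    · intro h
      have h1 : ‖(x : ℚ_[p])‖ ≤ 1 := Padic.norm_rat_le_one hden
      have h2 : (1 : ℝ) < (p : ℝ) ^ m := one_lt_pow₀ hpR (by omega)
      linarith
    · intro h
      exact absurd (dvd_trans (dvd_pow_self p (by omega)) h) hden

end RatPoints

section RatCurve

variable (W : WeierstrassCurve ℚ) [W.IsElliptic] [W.IsGloballyMinimal] (p : ℕ) [hp : Fact p.Prime]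

/-- **THE LEVEL CRITERION ON RATIONAL POINTS.** `W/ℚ` globally minimal, ADDITIVE at `p ≥ 5`, `W(ℚ_p)[p] = 0`; `P ∈ W(ℚ)`
with `12 • P = (x, y)`; `k ≥ 1`. Then `ι P ∈ p^k W(ℚ_p)` (`ι = toPadicPoint`, the crux's level binder
`∃ Q : W(ℚ_[p]), p^k • Q = ι P`) **iff `p^{2k} ∣ den x`**. [cite: SilvermanAEC2009, VII.2 Prop. 2.1–2.2, IV.6.4, VII.6.1, VII.6.3] -/
theorem exists_pow_nsmul_eq_toPadicPoint_iff_pow_dvd_den (hp5 : 5 ≤ p) (hadd : Addv W p)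
    (htors : ∀ Q : (W.baseChange ℚ_[p]).toAffine.Point, p • Q = 0 → Q = 0)
    {P : W.toAffine.Point} {x y : ℚ} {hxy : W.toAffine.Nonsingular x y} (h12 : 12 • P = .some x y hxy)
    {k : ℕ} (hk : 1 ≤ k) :
    (∃ Q : (W.baseChange ℚ_[p]).toAffine.Point, p ^ k • Q = W.toPadicPoint p P) ↔ p ^ (2 * k) ∣ x.den := by
  haveI : (W.baseChange ℚ_[p]).IsElliptic := by rw [baseChange]; infer_instance
  rw [exists_pow_nsmul_eq_iff_nsmul_mem_formalFiltration W p hp5 hadd htors _ hk, ← map_nsmul, h12,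
    toPadicPoint_some, some_mem_formalFiltration_iff _ hk, pow_le_norm_ratCast_iff_pow_dvd_den x (by omega)]

/-- **Necessity at ANY additive prime** (no hypothesis on `p` or on the local torsion): if `ι P ∈ p^k W(ℚ_p)` (`k ≥ 1`) and
`12 • P = (x, y)` then `p^{2k} ∣ den x`. [cite: SilvermanAEC2009, VII.2 Prop. 2.1–2.2, Thm VII.6.1] -/
theorem pow_dvd_den_of_exists_pow_nsmul_eq_toPadicPoint (hadd : Addv W p)
    {P : W.toAffine.Point} {x y : ℚ} {hxy : W.toAffine.Nonsingular x y} (h12 : 12 • P = .some x y hxy)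
    {k : ℕ} (hk : 1 ≤ k) (h : ∃ Q : (W.baseChange ℚ_[p]).toAffine.Point, p ^ k • Q = W.toPadicPoint p P) :
    p ^ (2 * k) ∣ x.den := by
  haveI : (W.baseChange ℚ_[p]).IsElliptic := by rw [baseChange]; infer_instance
  obtain ⟨Q, hQ⟩ := h
  have h1 := nsmul_mem_formalFiltration_of_pow_nsmul_eq W p hadd hk hQ
  rw [← map_nsmul, h12, toPadicPoint_some, some_mem_formalFiltration_iff _ hk] at h1
  exact (pow_le_norm_ratCast_iff_pow_dvd_den x (by omega)).mp h1

/-- **THE CM-RAMIFIED CLASS MEMBER** (`W/ℚ` globally minimal with CM, `CMRamified W p`, `p ≥ 5` — additive at `p` by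
`X12.addv_of_hasCM_of_cmRamified'`, `W(ℚ_p)[p] = 0` by k7r's `prime_nsmul_eq_zero_padic_of_hasCM_of_cmRamified`): for every rational
point `P` with `12 • P = (x, y)` and every `k ≥ 1`, **`ι P ∈ p^k W(ℚ_p)` iff `p^{2k} ∣ den x`**. In particular the crux's
B1-level premise «the generator is `p`-divisible in `W(ℚ_p)`» reads «`p² ∣ den x(12 • g)`» (⟺ `p ∣ den x(12 • g)`, the
denominator being a square). [cite: SilvermanAEC2009, VII.2 Prop. 2.1–2.2, IV.6.4, VII.6.1, VII.6.3]
[cite: SilvermanATAEC1994, Cor. IV.9.2(d) and App. A §3] -/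
theorem exists_pow_nsmul_eq_toPadicPoint_iff_pow_dvd_den_of_cmRamified (hCM : W.HasCM) (hram : CMRamified W p)
    (h5 : 5 ≤ p) {P : W.toAffine.Point} {x y : ℚ} {hxy : W.toAffine.Nonsingular x y} (h12 : 12 • P = .some x y hxy)
    {k : ℕ} (hk : 1 ≤ k) :
    (∃ Q : (W.baseChange ℚ_[p]).toAffine.Point, p ^ k • Q = W.toPadicPoint p P) ↔ p ^ (2 * k) ∣ x.den :=
  exists_pow_nsmul_eq_toPadicPoint_iff_pow_dvd_den W p h5
    (Summit.BirchSwinnertonDyer.Rank1Residual.X12.addv_of_hasCM_of_cmRamified' W p hCM hram)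
    (RamifiedSevenEllipticUnits.prime_nsmul_eq_zero_padic_of_hasCM_of_cmRamified W p hCM h5 hram) h12 hk

end RatCurve

end Summit.BirchSwinnertonDyer.BirchSwinnertonDyer.Theorems.PrintCFram.LevelCriterion

end
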